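/-
Copyright (c) 2026 the pub-hodgecm-mathlib formalisation cell (harness21).  Prover seat hodgecm-mathlib-K2E1-p12 (g7), Track B ∕ R90-TF, h413 = `stmt-HodgeConjecture-24833`,
R90-TF section S8 «ContSpec-n½», socket (E) :276, E1-PLANCHEREL BODY brick PB-2d′ «AXIS POLE EXCLUSION» (sequel of ★ PB-2d p865367 `K2E1PseudoEisensteinEntryLettersOfExports`, S8
dealer R90-CS-plan (g4) S8-R280 (3)): the ON-AXIS half of PB-2d's pole-ledger letter DISCHARGED — a continued scattering coordinate in meromorphic normal form that is bounded along
the unitary axis off the candidate set is analytic at every axis point ([MoeglinWaldspurger1995] IV.1.11 (b), proof IV.3.12 ¶1) — and ★ PB-2d's `entry_hs_of_exports` re-keyed on TRUE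
poles in the OPEN strip.  Pure complex analysis, on letters.
-/
import Summits.HodgeConjecture.HodgeConjecture.Theorems.K2E1PseudoEisensteinEntryLettersOfExports   -- ★ PB-2d (this seat): `entry_hs_of_exports`, `isClosed_of_subset_codiscrete`; brings ★ PB-2a′ and the analysis imports
import Mathlib.Analysis.Meromorphic.NormalForm
import Mathlib.Analysis.SpecificLimits.Basic
import HarnessLib

/-!
# PB-2d′ — `K2E1PseudoEisensteinAxisPoleExclusion`: no poles of the continued scattering coordinates ON the unitary axis (meromorphic normal form + boundedness along the axis), and the
# entry letter `hs` of the vector contour shift re-keyed on the TRUE poles in the OPEN strip (pure complex analysis, on letters)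

Track B ∕ R90-TF, crux h413 = `stmt-HodgeConjecture-24833`, route of record `HCCMUnconditional`; cell `hodgecm-mathlib`, R90-TF programme, section S8 «ContSpec-n½», socket (E)
(B ED. 7 :276): the E1-PLANCHEREL BODY at the τ-cut block; PB-2 chain ★ (p865234, p865274, p865294, p865306, p865331, p865367).  THIS FILE = PB-2d′.  THEOREMS ONLY (no `def`, no
`instance`, no `notation`, no named-fact hypothesis, no `sorry`; default heartbeats); lane `--supports stmt-HodgeConjecture-24833 --as helper` (count-neutral).  No automorphic object.
CLOSES NO SOCKET.

THE MATHEMATICS ([MoeglinWaldspurger1995, IV.1.11 (b)(d); proof IV.3.12, pp. 161–162]; [Langlands1976, §7]).  ★ PB-2d reduced the entry letter `hs` of ★ PB-2a′ to the exports' holomorphy off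
their candidate pole sets `P_a` and ONE pole-ledger letter `P_a ∩ {κ ≤ Re z ≤ σ₀} ⊆ S`.  Two refinements make that letter honest and halve it.  (A) The exports' `P_a` is a CANDIDATE set
(zeros of the Bernstein–Lapid determinant may be removable); what matters is the TRUE pole set `P†_a := {z | ∃ j, qc_j^{(a)} is not analytic at z} ⊆ P_a` — still co-discrete, and the
coordinates are holomorphic off it — so ★ `entry_hs_of_exports` runs on `P†` with the ledger stated for true poles only (§3).  (B) ON THE UNITARY AXIS `Re z = κ` there are no true poles
([MW IV.1.11 (b)]; proof IV.3.12 ¶1: where `M(w,·)` is holomorphic on the axis the functional equation and the adjunction give `⟨M(z)φ, M(z)φ⟩ = ⟨φ, φ⟩`, so the matrix coefficients — hence,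
the columns being linearly independent, the coordinates `qc_j` — stay BOUNDED along the axis off `P_a`; a pole at an axis point would force them to blow up along every approach).
Formally (§1, Mathlib-only): a function in MEROMORPHIC NORMAL FORM at `x` (★ exports: `MeromorphicNFOn (qc j) univ`) whose norm is `≤ C` FREQUENTLY on the punctured neighbourhood of `x`
is analytic at `x` (`tendsto_cobounded_of_meromorphicOrderAt_neg` ∘ `MeromorphicNFAt.meromorphicOrderAt_nonneg_iff_analyticAt`); and (§2) the punctured vertical line through `x` off a
co-discrete `P` accumulates at `x` (the sequence `κ + i(t₀ + 1∕(n+1))`).  HENCE (§2 HEAD) **`analyticAt_axis_of_normBound`**: `MeromorphicNFOn q univ`, `P` co-discrete, and the AXIS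
BOUND **(hunit)** `‖q(κ+it)‖ ≤ C` whenever `κ+it ∉ P` ⇒ `q` analytic at every `κ + it₀`; and (§3 HEAD) **`entry_hs_of_exports_of_axisBound`**: ★ PB-2a′'s `hUo hUs hs` bytes from the
exports (normal form, candidate set, analyticity off it), the axis bounds `hunit` per coordinate, and the OPEN-STRIP TRUE-POLE LEDGER **(hPℓo)** `(∃ j, ¬AnalyticAt (qc_j^{(a)}) z) → κ < Re z
→ Re z ≤ σ₀ → z ∈ S` — [MW IV.1.11 (d) + IV.3.12 p. 162: finitely many, real (`π⊗λ = −w(π̄⊗λ̄)`)], on the SCALAR ROAD the statement «the continued coordinates `qc_j = A·L`-ratio have their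
strip poles at real points» (F5 ∕ CS-p03).  The axis bound `hunit` is the coordinate form of the unitarity letter `hc1` (⇐ `hFE` + `hcs`, ★ `hc1_of_functionalEquation`).
* §1 `analyticAt_of_meromorphicNFAt_of_frequently_norm_le`.  * §2 `tendsto_axisSeq`, `frequently_norm_le_of_axisBound`, **`analyticAt_axis_of_normBound`**.
* §3 `codiscrete_truePoles`, `differentiableOn_compl_truePoles`, **`entry_hs_of_exports_of_axisBound`**.
HONEST LABEL: HC_CM is proved only modulo the 7 printed citations (2 remaining named inputs: hLiu418 = `stmt-HodgeConjecture-24832`, h413 = `stmt-HodgeConjecture-24833`) until rung 0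
closes; this file asserts no named fact, closes no socket; count-neutral; `hunit` (axis unitarity in coordinates) and `hPℓo` (open-strip true-pole ledger, scalar road) are HYPOTHESES.

## References
* [MoeglinWaldspurger1995] C. Mœglin, J.-L. Waldspurger, *Spectral decomposition and Eisenstein series* (1995), IV.1.11 (b)(d); IV.3.12 (proof), pp. 161–162.
* [Langlands1976] R. P. Langlands, *On the Functional Equations Satisfied by Eisenstein Series*, LNM 544 (1976), §7.
-/

set_option autoImplicit false
set_option linter.dupNamespace false  -- the mandated namespace repeats the summit's segment (`HodgeConjecture.HodgeConjecture`)

noncomputable section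

open Set Filter Topology Complex Bornology
open scoped ComplexConjugate BigOperators
open Summit.HodgeConjecture.HodgeConjecture.Cruxes.H413.K2E1PseudoEisensteinEntryLettersOfExports (entry_hs_of_exports)

namespace Summit.HodgeConjecture.HodgeConjecture.Cruxes.H413.K2E1PseudoEisensteinAxisPoleExclusion

/-! ## §1 Normal form + frequent boundedness ⇒ analytic -/

/-- **A FUNCTION IN MEROMORPHIC NORMAL FORM THAT IS FREQUENTLY BOUNDED NEAR `x` IS ANALYTIC AT `x`**: if `MeromorphicNFAt q x` and `‖q z‖ ≤ C` frequently on `𝓝[≠] x`, then `AnalyticAt ℂ q x`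
(a negative order forces `‖q‖ → ∞` on the whole punctured neighbourhood, Mathlib `tendsto_cobounded_of_meromorphicOrderAt_neg`; non-negative order in normal form is analyticity,
`MeromorphicNFAt.meromorphicOrderAt_nonneg_iff_analyticAt`). [cite: MoeglinWaldspurger1995, IV.3.12] -/
theorem analyticAt_of_meromorphicNFAt_of_frequently_norm_le {q : ℂ → ℂ} {x : ℂ} (hq : MeromorphicNFAt q x) {C : ℝ} (hb : ∃ᶠ z in 𝓝[≠] x, ‖q z‖ ≤ C) :
    AnalyticAt ℂ q x := by
  rw [← hq.meromorphicOrderAt_nonneg_iff_analyticAt]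
  by_contra ho
  have ht : Tendsto (fun z => ‖q z‖) (𝓝[≠] x) atTop := tendsto_norm_atTop_iff_cobounded.2 (tendsto_cobounded_of_meromorphicOrderAt_neg (not_le.1 ho))
  obtain ⟨z, hz1, hz2⟩ := (hb.and_eventually (ht.eventually_gt_atTop C)).exists
  exact absurd hz1 (not_le.2 hz2)

/-! ## §2 No poles on the axis from an axis bound off a co-discrete candidate set -/

/-- The axis sequence `κ + i(t₀ + 1∕(n+1))` tends to `κ + it₀` WITHIN the punctured neighbourhood. [folklore] -/
theorem tendsto_axisSeq (κ t₀ : ℝ) :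
    Tendsto (fun n : ℕ => (κ : ℂ) + ((t₀ + 1 / ((n : ℝ) + 1) : ℝ) : ℂ) * I) atTop (𝓝[≠] ((κ : ℂ) + (t₀ : ℂ) * I)) := by
  refine tendsto_nhdsWithin_iff.2 ⟨?_, Eventually.of_forall fun n => ?_⟩
  · have h1 : Tendsto (fun n : ℕ => t₀ + 1 / ((n : ℝ) + 1)) atTop (𝓝 t₀) := by
      simpa using tendsto_const_nhds.add (tendsto_one_div_add_atTop_nhds_zero_nat (𝕜 := ℝ))
    have h2 : Tendsto (fun n : ℕ => ((t₀ + 1 / ((n : ℝ) + 1) : ℝ) : ℂ)) atTop (𝓝 (t₀ : ℂ)) := (continuous_ofReal.tendsto t₀).comp h1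
    exact tendsto_const_nhds.add (h2.mul tendsto_const_nhds)
  · intro h
    have him := congrArg Complex.im h
    simp only [add_im, ofReal_im, mul_im, ofReal_re, I_re, I_im, mul_zero, mul_one, zero_add, add_zero] at him
    have hpos : (0 : ℝ) < 1 / ((n : ℝ) + 1) := by positivity
    linarith

/-- **FREQUENT AXIS BOUND**: if `‖q(κ+it)‖ ≤ C` for every axis point off a co-discrete `P`, then `‖q z‖ ≤ C` frequently on the punctured neighbourhood of every axis point `κ + it₀`
(along the axis sequence, which is eventually off `P`). [folklore] -/
theorem frequently_norm_le_of_axisBound {q : ℂ → ℂ} {P : Set ℂ} (hPd : ∀ z₀ : ℂ, ∀ᶠ s in 𝓝[≠] z₀, s ∉ P) (κ : ℝ) {C : ℝ}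
    (hunit : ∀ t : ℝ, ((κ : ℂ) + (t : ℂ) * I) ∉ P → ‖q ((κ : ℂ) + (t : ℂ) * I)‖ ≤ C) (t₀ : ℝ) :
    ∃ᶠ z in 𝓝[≠] ((κ : ℂ) + (t₀ : ℂ) * I), ‖q z‖ ≤ C := by
  have hT := tendsto_axisSeq κ t₀
  have hev : ∀ᶠ n : ℕ in atTop, ‖q ((κ : ℂ) + ((t₀ + 1 / ((n : ℝ) + 1) : ℝ) : ℂ) * I)‖ ≤ C :=
    (hT.eventually (hPd _)).mono fun n hn => hunit _ hn
  exact hT.frequently hev.frequently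

/-- **HEAD (§2) — NO POLE ON THE UNITARY AXIS** ([MW IV.1.11 (b)], proof IV.3.12 ¶1): a continued coordinate `q` in MEROMORPHIC NORMAL FORM on `ℂ` (★ exports' `MeromorphicNFOn (qc j) univ`),
a co-discrete candidate set `P` (★ exports), and the AXIS BOUND **(hunit)** `‖q(κ+it)‖ ≤ C` at every axis point off `P` (the coordinate form of the unitarity of `M(w₀,·)|_V` on
`Re z = κ` where holomorphic: `⟨M(z)φ, M(z)φ⟩ = ⟨φ, φ⟩`) ⇒ `q` is ANALYTIC at every axis point `κ + it₀` (in or out of `P`). [cite: MoeglinWaldspurger1995, IV.1.11, IV.3.12] -/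
theorem analyticAt_axis_of_normBound {q : ℂ → ℂ} (hNF : MeromorphicNFOn q univ) {P : Set ℂ} (hPd : ∀ z₀ : ℂ, ∀ᶠ s in 𝓝[≠] z₀, s ∉ P) (κ : ℝ) {C : ℝ}
    (hunit : ∀ t : ℝ, ((κ : ℂ) + (t : ℂ) * I) ∉ P → ‖q ((κ : ℂ) + (t : ℂ) * I)‖ ≤ C) (t₀ : ℝ) :
    AnalyticAt ℂ q ((κ : ℂ) + (t₀ : ℂ) * I) :=
  analyticAt_of_meromorphicNFAt_of_frequently_norm_le (hNF (mem_univ _)) (frequently_norm_le_of_axisBound hPd κ hunit t₀)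

/-! ## §3 ★ PB-2d's `hs` re-keyed on TRUE poles in the OPEN strip -/

section TruePoles

variable {α ι : Type*}

/-- The TRUE pole set `{z | ∃ j, ¬ AnalyticAt (qc_j^{(a)}) z}` is contained in the exports' candidate set, hence co-discrete. [folklore] -/
theorem codiscrete_truePoles (qc : α → ι → ℂ → ℂ) (P : α → Set ℂ) (hPd : ∀ a, ∀ z₀ : ℂ, ∀ᶠ s in 𝓝[≠] z₀, s ∉ P a)
    (han : ∀ a j (z : ℂ), z ∉ P a → AnalyticAt ℂ (qc a j) z) (a : α) (z₀ : ℂ) :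
    ∀ᶠ s in 𝓝[≠] z₀, s ∉ {z : ℂ | ∃ j, ¬AnalyticAt ℂ (qc a j) z} := by
  filter_upwards [hPd a z₀] with s hs
  simp only [not_exists, not_not]
  exact fun j => han a j s hs

/-- The coordinates are holomorphic off the true pole set (analytic at each point of its complement). [folklore] -/
theorem differentiableOn_compl_truePoles (qc : α → ι → ℂ → ℂ) (a : α) (j : ι) :
    DifferentiableOn ℂ (qc a j) {z : ℂ | ∃ j, ¬AnalyticAt ℂ (qc a j) z}ᶜ := by
  intro z hz
  simp only [mem_compl_iff, mem_setOf_eq, not_exists, not_not] at hz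
  exact (hz j).differentiableAt.differentiableWithinAt

/-- **HEAD (§3) — `hs` OF ★ PB-2a′ FROM THE EXPORTS, THE AXIS BOUNDS AND THE OPEN-STRIP TRUE-POLE LEDGER.**  Data per section `a` and coordinate `j`: `qc_j^{(a)}` in meromorphic normal form
on `ℂ`, analytic off a co-discrete candidate set `P_a` (★ exports, three of their clauses verbatim); constant Gram entries `G_{abj}`; the axis `κ`; AXIS BOUNDS **(hunit)** `‖qc_j^{(a)}(κ+it)‖
≤ C` off `P_a` (§2; unitarity on `Re z = κ`); and the OPEN-STRIP TRUE-POLE LEDGER **(hPℓo)** `(∃ j, qc_j^{(a)} not analytic at z) → κ < Re z → Re z ≤ σ₀ → z ∈ S` (`S` a finset of reals;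
[MW IV.1.11 (d), IV.3.12 p. 162]; scalar road).  CONCLUSION: `∃ U` open `⊇ {κ ≤ Re z ≤ σ₀}` with every entry `z ↦ Σ_j qc_j^{(a)}(z)·G_{abj}` holomorphic on `U ∖ S` — ★ PB-2a′'s `hUo hUs hs`
bytes (★ PB-2d `entry_hs_of_exports` on the true pole sets; the closed-strip slice `Re z = κ` of its ledger is killed by §2). [cite: MoeglinWaldspurger1995, IV.1.11, IV.3.12] [cite: Langlands1976, §7] -/
theorem entry_hs_of_exports_of_axisBound {β : Type*} [Finite α] [Fintype ι] (qc : α → ι → ℂ → ℂ) (G : α → β → ι → ℂ) (P : α → Set ℂ)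
    (hNF : ∀ a j, MeromorphicNFOn (qc a j) univ) (hPd : ∀ a, ∀ z₀ : ℂ, ∀ᶠ s in 𝓝[≠] z₀, s ∉ P a) (han : ∀ a j (z : ℂ), z ∉ P a → AnalyticAt ℂ (qc a j) z)
    (κ σ₀ : ℝ) (S : Finset ℝ) {C : ℝ} (hunit : ∀ a j (t : ℝ), ((κ : ℂ) + (t : ℂ) * I) ∉ P a → ‖qc a j ((κ : ℂ) + (t : ℂ) * I)‖ ≤ C)
    (hPℓo : ∀ a (z : ℂ), (∃ j, ¬AnalyticAt ℂ (qc a j) z) → κ < z.re → z.re ≤ σ₀ → z ∈ ((S.image fun c : ℝ => (c : ℂ)) : Set ℂ)) :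
    ∃ U : Set ℂ, IsOpen U ∧ {z : ℂ | κ ≤ z.re ∧ z.re ≤ σ₀} ⊆ U ∧
      ∀ a b, DifferentiableOn ℂ (fun z : ℂ => ∑ j, qc a j z * G a b j) (U \ ((S.image fun c : ℝ => (c : ℂ)) : Set ℂ)) := by
  refine entry_hs_of_exports qc G (fun a => {z : ℂ | ∃ j, ¬AnalyticAt ℂ (qc a j) z}) (codiscrete_truePoles qc P hPd han)
    (fun a j => differentiableOn_compl_truePoles qc a j) S fun a z hz h1 h2 => ?_
  rcases lt_or_eq_of_le h1 with h | h
  · exact hPℓo a z hz h h2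
  · -- `Re z = κ`: `z` is an axis point, where every coordinate is analytic (§2) — no true pole there
    obtain ⟨j, hj⟩ := hz
    have hzax : z = (κ : ℂ) + (z.im : ℂ) * I := by rw [h, re_add_im]
    exact absurd (hzax ▸ analyticAt_axis_of_normBound (hNF a j) (hPd a) κ (hunit a j) z.im) hj

end TruePoles

end Summit.HodgeConjecture.HodgeConjecture.Cruxes.H413.K2E1PseudoEisensteinAxisPoleExclusion

end
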